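import Literature.Analysis.FunctionSpaces.TorusSymbolCalculus
import Literature.Analysis.FunctionSpaces.LatticeCutoffComm
import Literature.Analysis.FunctionSpaces.LatticePairing
import Literature.Analysis.FunctionSpaces.TorusTrigPoly
import HarnessLib

/-!
# Cut-off chains on the torus and the symbol identities of Warner 6.32 (15)

F. W. Warner, GTM 94 (1983), 6.32 (15): "`M₂ũ = M₂v₁`, since `M₂ = L̃ω₂ − ω₂L̃` has support in
`O₁` and `ũ = v₁ = ω₁ũ` on `O₁`". On the lattice side this locality is
`Lattice.POp1.apply_conv_scal_eq`, whose hypotheses are three products of symbols. Here we derive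
them from the torus-function facts for a pair of cut-offs `χ`, `ψ` with `ψ = 1` on an open set
containing the closed support of `χ` (`Torus.PlateauPair`): the dictionary scalar function ↔ scalar
symbol (`scal (𝓕χ)`, products, derivatives, the unit), the vanishing of `∂χ·(ψ−1)`, `∂∂χ·(ψ−1)`,
`∂χ·∂ψ`, and finally `cutoffComm_apply_conv_scal_eq`:
`[L, χ⋆](ψ ⋆ u) = [L, χ⋆] u`. Also: the adjoint symbol of a real scalar cut-off is itself.

## References

* F. W. Warner, GTM 94 (1983), 6.32 (15). [WarnerGTM94]
-/

noncomputable section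

open Set Filter Function MeasureTheory UnitAddTorus Complex
open scoped Topology ContDiff

namespace Literature.Analysis.FunctionSpaces

namespace Torus

open Lattice

variable {d : Type*} [Fintype d]
variable {V W : Type*} [NormedAddCommGroup V] [NormedSpace ℂ V] [NormedAddCommGroup W] [NormedSpace ℂ W]

/-! ### Scalar functions and scalar symbols -/

/-- Fourier coefficients of `f • c` for a constant vector `c`. [folklore] -/
theorem mFourierCoeff_smul_const [CompleteSpace W] (f : UnitAddTorus d → ℂ) (c : W) (k : d → ℤ) :
    mFourierCoeff (fun x => f x • c) k = mFourierCoeff f k • c := by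
  rw [mFourierCoeff_eq_integral_volume, mFourierCoeff_eq_integral_volume, ← integral_smul_const]
  exact integral_congr_ae (Eventually.of_forall fun x => by simp [smul_smul])

/-- **The scalar symbol of a cut-off is the symbol of the multiplier `χ • 1`.** [folklore] -/
theorem scal_mFourierCoeff [CompleteSpace V] (χ : UnitAddTorus d → ℂ) :
    (scal (mFourierCoeff χ) : (d → ℤ) → (V →L[ℂ] V)) = mFourierCoeff (fun x => χ x • (1 : V →L[ℂ] V)) := by
  funext k
  rw [scal_apply, mFourierCoeff_smul_const]

variable [DecidableEq d] [CompleteSpace V]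

/-- **Products of cut-offs**: `scal 𝓕χ ⋆ scal 𝓕ψ = scal 𝓕(χψ)`. [folklore] -/
theorem sconv_scal_mFourierCoeff {χ ψ : UnitAddTorus d → ℂ} (hχ : IsSmooth χ) (hψ : IsSmooth ψ) :
    sconv (scal (mFourierCoeff χ) : (d → ℤ) → (V →L[ℂ] V)) (scal (mFourierCoeff ψ)) =
      scal (mFourierCoeff (fun x => χ x * ψ x)) := by
  rw [scal_mFourierCoeff, scal_mFourierCoeff, scal_mFourierCoeff,
    ← IsSmooth.mFourierCoeff_clm_comp (hχ.smul_complex (isSmooth_const _)) (hψ.smul_complex (isSmooth_const _))]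
  congr 1
  funext x
  ext v
  simp [smul_smul, mul_comm]

omit [CompleteSpace V] in
/-- **Derivatives of cut-offs**: `∂_j (scal 𝓕χ) = scal 𝓕(∂_jχ)`. [folklore] -/
theorem freqDeriv_scal_mFourierCoeff {χ : UnitAddTorus d → ℂ} (hχ : IsSmooth χ) (j : d) :
    freqDeriv j (scal (mFourierCoeff χ) : (d → ℤ) → (V →L[ℂ] V)) = scal (mFourierCoeff (Torus.partialDeriv j χ)) := by
  rw [freqDeriv_scal, hχ.mFourierCoeff_partialDeriv_eq_freqDeriv]

omit [DecidableEq d] [CompleteSpace V] in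
/-- The Fourier coefficients of the constant `1`. [folklore] -/
theorem mFourierCoeff_const_one (k : d → ℤ) : mFourierCoeff (fun _ : UnitAddTorus d => (1 : ℂ)) k = if k = 0 then 1 else 0 := by
  classical
  have h : (fun _ : UnitAddTorus d => (1 : ℂ)) = trigPoly {0} (fun _ => (1 : ℂ)) := by
    funext x; simp [trigPoly_apply, mFourier_zero]
  rw [h, mFourierCoeff_trigPoly]
  simp

omit [DecidableEq d] [CompleteSpace V] in
/-- **The unit symbol is the symbol of the constant cut-off `1`.** [folklore] -/
theorem delta_one_eq_scal : (delta (1 : V →L[ℂ] V) : (d → ℤ) → (V →L[ℂ] V)) =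
    scal (mFourierCoeff (fun _ : UnitAddTorus d => (1 : ℂ))) := by
  funext k
  rw [delta_apply, scal_apply, mFourierCoeff_const_one]
  split_ifs <;> simp

omit [DecidableEq d] [CompleteSpace V] in
/-- `scal 𝓕ψ - delta 1 = scal 𝓕(ψ - 1)`. [folklore] -/
theorem scal_sub_delta_one {ψ : UnitAddTorus d → ℂ} (hψ : IsSmooth ψ) :
    (scal (mFourierCoeff ψ) : (d → ℤ) → (V →L[ℂ] V)) - delta 1 = scal (mFourierCoeff (fun x => ψ x - 1)) := by
  rw [delta_one_eq_scal, ← scal_sub]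
  congr 1
  funext k
  rw [Pi.sub_apply, ← mFourierCoeff_sub hψ.integrable (isSmooth_const (1 : ℂ)).integrable]
  rfl

/-! ### Locality of torus derivatives -/

omit [CompleteSpace V] in
/-- `∂_j` is local. [folklore] -/
theorem partialDeriv_congr_of_eventuallyEq {f g : UnitAddTorus d → W} {x : UnitAddTorus d}
    (h : f =ᶠ[𝓝 x] g) (j : d) : Torus.partialDeriv j f x = Torus.partialDeriv j g x := by
  unfold Torus.partialDeriv Torus.lineDeriv
  refine Filter.EventuallyEq.deriv_eq ?_
  have hc : Tendsto (fun t : ℝ => x + proj (t • EuclideanSpace.single j (1 : ℝ))) (𝓝 0) (𝓝 x) := by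
    have : Continuous fun t : ℝ => x + proj (t • EuclideanSpace.single j (1 : ℝ)) :=
      continuous_const.add (continuous_proj.comp (continuous_id.smul continuous_const))
    have h0 := this.continuousAt (x := 0)
    rwa [ContinuousAt, zero_smul, proj_zero, add_zero] at h0
  exact hc.eventually h

omit [CompleteSpace V] in
/-- A function constant near `x` has `∂_j = 0` at `x`. [folklore] -/
theorem partialDeriv_eq_zero_of_eventuallyEq_const {f : UnitAddTorus d → W} {x : UnitAddTorus d} {c : W}
    (h : ∀ᶠ y in 𝓝 x, f y = c) (j : d) : Torus.partialDeriv j f x = 0 := by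
  rw [partialDeriv_congr_of_eventuallyEq (g := fun _ => c) h j]
  simp [Torus.partialDeriv, Torus.lineDeriv]

omit [CompleteSpace V] in
/-- `tsupport (∂_j f) ⊆ tsupport f`. [folklore] -/
theorem tsupport_partialDeriv_subset (f : UnitAddTorus d → W) (j : d) :
    tsupport (Torus.partialDeriv j f) ⊆ tsupport f := by
  refine closure_minimal (fun x hx => ?_) (isClosed_tsupport f)
  by_contra hxs
  refine hx (partialDeriv_eq_zero_of_eventuallyEq_const (c := 0) ?_ j)
  filter_upwards [(isClosed_tsupport f).isOpen_compl.mem_nhds hxs] with y hy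
  exact image_eq_zero_of_notMem_tsupport hy

/-! ### Plateau pairs -/

/-- **A plateau pair**: smooth complex cut-offs `χ`, `ψ` with `ψ = 1` on an open set containing the
closed support of `χ` (Warner 6.32: `ω_n ≡ 1` on `O_n ⊇ supp ω_{n+1}`). [cite: WarnerGTM94, 6.32] -/
structure PlateauPair (χ ψ : UnitAddTorus d → ℂ) : Prop where
  smooth_left : IsSmooth χ
  smooth_right : IsSmooth ψ
  exists_open : ∃ U : Set (UnitAddTorus d), IsOpen U ∧ tsupport χ ⊆ U ∧ ∀ x ∈ U, ψ x = 1

namespace PlateauPair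

variable {χ ψ : UnitAddTorus d → ℂ}

omit [DecidableEq d] [CompleteSpace V] in
/-- `ψ = 1` near every point of the closed support of `χ`. [folklore] -/
theorem eventually_eq_one (h : PlateauPair χ ψ) {x : UnitAddTorus d} (hx : x ∈ tsupport χ) :
    ∀ᶠ y in 𝓝 x, ψ y = 1 := by
  obtain ⟨U, hU, hsub, h1⟩ := h.exists_open
  exact eventually_of_mem (hU.mem_nhds (hsub hx)) h1

omit [CompleteSpace V] in
/-- **`∂_jχ · (ψ - 1) = 0`.** [cite: WarnerGTM94, 6.32] -/
theorem partialDeriv_mul_sub_one (h : PlateauPair χ ψ) (j : d) (x : UnitAddTorus d) :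
    Torus.partialDeriv j χ x * (ψ x - 1) = 0 := by
  by_cases hx : x ∈ tsupport χ
  · rw [(h.eventually_eq_one hx).self_of_nhds, sub_self, mul_zero]
  · rw [image_eq_zero_of_notMem_tsupport (fun h' => hx (tsupport_partialDeriv_subset χ j h')), zero_mul]

omit [CompleteSpace V] in
/-- **`∂_i∂_jχ · (ψ - 1) = 0`.** [cite: WarnerGTM94, 6.32] -/
theorem partialDeriv_partialDeriv_mul_sub_one (h : PlateauPair χ ψ) (i j : d) (x : UnitAddTorus d) :
    Torus.partialDeriv i (Torus.partialDeriv j χ) x * (ψ x - 1) = 0 := by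
  by_cases hx : x ∈ tsupport χ
  · rw [(h.eventually_eq_one hx).self_of_nhds, sub_self, mul_zero]
  · rw [image_eq_zero_of_notMem_tsupport (fun h' => hx
      (tsupport_partialDeriv_subset χ j (tsupport_partialDeriv_subset _ i h'))), zero_mul]

omit [CompleteSpace V] in
/-- **`∂_jχ · ∂_iψ = 0`.** [cite: WarnerGTM94, 6.32] -/
theorem partialDeriv_mul_partialDeriv (h : PlateauPair χ ψ) (i j : d) (x : UnitAddTorus d) :
    Torus.partialDeriv j χ x * Torus.partialDeriv i ψ x = 0 := by
  by_cases hx : x ∈ tsupport χ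
  · rw [partialDeriv_eq_zero_of_eventuallyEq_const (h.eventually_eq_one hx) i, mul_zero]
  · rw [image_eq_zero_of_notMem_tsupport (fun h' => hx (tsupport_partialDeriv_subset χ j h')), zero_mul]

/-! ### The symbol identities and the locality of the cut-off commutator -/

/-- `scal 𝓕(∂_jχ) ⋆ (scal 𝓕ψ - delta 1) = 0`. [cite: WarnerGTM94, 6.32 (15)] -/
theorem sconv_deriv_sub_delta (h : PlateauPair χ ψ) (j : d) :
    sconv (scal (mFourierCoeff (Torus.partialDeriv j χ)) : (d → ℤ) → (V →L[ℂ] V))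
      (scal (mFourierCoeff ψ) - delta 1) = 0 := by
  have hs : IsSmooth (fun x => ψ x - 1) := h.smooth_right.sub (isSmooth_const _)
  rw [scal_sub_delta_one h.smooth_right, sconv_scal_mFourierCoeff (h.smooth_left.partialDeriv j) hs]
  have : (fun x => Torus.partialDeriv j χ x * (ψ x - 1)) = fun _ => 0 := funext fun x => h.partialDeriv_mul_sub_one j x
  rw [this]
  funext k; simp [mFourierCoeff_eq_integral_volume]

/-- `scal 𝓕(∂_i∂_jχ) ⋆ (scal 𝓕ψ - delta 1) = 0`. [cite: WarnerGTM94, 6.32 (15)] -/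
theorem sconv_deriv_deriv_sub_delta (h : PlateauPair χ ψ) (i j : d) :
    sconv (scal (mFourierCoeff (Torus.partialDeriv i (Torus.partialDeriv j χ))) : (d → ℤ) → (V →L[ℂ] V))
      (scal (mFourierCoeff ψ) - delta 1) = 0 := by
  have hs : IsSmooth (fun x => ψ x - 1) := h.smooth_right.sub (isSmooth_const _)
  rw [scal_sub_delta_one h.smooth_right, sconv_scal_mFourierCoeff ((h.smooth_left.partialDeriv j).partialDeriv i) hs]
  have : (fun x => Torus.partialDeriv i (Torus.partialDeriv j χ) x * (ψ x - 1)) = fun _ => 0 :=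
    funext fun x => h.partialDeriv_partialDeriv_mul_sub_one i j x
  rw [this]
  funext k; simp [mFourierCoeff_eq_integral_volume]

/-- `scal 𝓕(∂_jχ) ⋆ ∂_i (scal 𝓕ψ) = 0`. [cite: WarnerGTM94, 6.32 (15)] -/
theorem sconv_deriv_freqDeriv (h : PlateauPair χ ψ) (i j : d) :
    sconv (scal (mFourierCoeff (Torus.partialDeriv j χ)) : (d → ℤ) → (V →L[ℂ] V))
      (freqDeriv i (scal (mFourierCoeff ψ))) = 0 := by
  rw [freqDeriv_scal_mFourierCoeff h.smooth_right, sconv_scal_mFourierCoeff (h.smooth_left.partialDeriv j)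
    (h.smooth_right.partialDeriv i)]
  have : (fun x => Torus.partialDeriv j χ x * Torus.partialDeriv i ψ x) = fun _ => 0 :=
    funext fun x => h.partialDeriv_mul_partialDeriv i j x
  rw [this]
  funext k; simp [mFourierCoeff_eq_integral_volume]

end PlateauPair

end Torus

/-! ### The cut-off commutator is local -/

namespace Lattice

open Torus

variable {d : Type*} [Fintype d] [DecidableEq d]
variable {V W : Type*} [NormedAddCommGroup V] [InnerProductSpace ℂ V] [NormedAddCommGroup W]
  [InnerProductSpace ℂ W] [CompleteSpace V] [CompleteSpace W]

omit [Fintype d] [DecidableEq d] [InnerProductSpace ℂ V] [InnerProductSpace ℂ W] [CompleteSpace V] [CompleteSpace W] in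
/-- `a ⋆ 0 = 0` for symbols. [folklore] -/
theorem sconv_zero [NormedSpace ℂ V] [NormedSpace ℂ W] {X : Type*} [NormedAddCommGroup X] [NormedSpace ℂ X]
    (a : (d → ℤ) → (W →L[ℂ] X)) : sconv a (0 : (d → ℤ) → (V →L[ℂ] W)) = 0 := by
  funext k; simp [sconv]

omit [Fintype d] [DecidableEq d] [InnerProductSpace ℂ V] [InnerProductSpace ℂ W] [CompleteSpace V] [CompleteSpace W] in
/-- `T ∘ 0 = 0` for symbols. [folklore] -/
theorem compLeft_zero [NormedSpace ℂ V] [NormedSpace ℂ W] {X : Type*} [NormedAddCommGroup X] [NormedSpace ℂ X]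
    (T : W →L[ℂ] X) : compLeft T (0 : (d → ℤ) → (V →L[ℂ] W)) = 0 := by
  funext k; simp [compLeft]

/-- **Warner 6.32 (15) for the cut-off commutator**: if `ψ = 1` near the support of `χ` then
`[L, χ⋆] (ψ ⋆ u) = [L, χ⋆] u` for every tempered `u`. [cite: WarnerGTM94, 6.32 (15)] -/
theorem POp.cutoffComm_apply_conv_scal_eq (L : POp d V W) {χ ψ : UnitAddTorus d → ℂ} (h : PlateauPair χ ψ)
    {u : (d → ℤ) → V} (hu : Tempered u) :
    (L.cutoffComm (mFourierCoeff χ) h.smooth_left.rapidDecay_mFourierCoeff).apply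
        (conv (scal (mFourierCoeff ψ)) u) =
      (L.cutoffComm (mFourierCoeff χ) h.smooth_left.rapidDecay_mFourierCoeff).apply u := by
  have hχ := h.smooth_left
  have hψ := h.smooth_right
  have hsχ : RapidDecay (scal (mFourierCoeff χ) : (d → ℤ) → (V →L[ℂ] V)) := hχ.rapidDecay_scal
  have hsψ : RapidDecay (scal (mFourierCoeff ψ) : (d → ℤ) → (V →L[ℂ] V)) := hψ.rapidDecay_scal
  have hsub : RapidDecay ((scal (mFourierCoeff ψ) : (d → ℤ) → (V →L[ℂ] V)) - delta 1) := by
    have := hsψ.add ((rapidDecay_delta (1 : V →L[ℂ] V)).const_smul (-1))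
    simpa [sub_eq_add_neg] using this
  -- derivatives of the cut-off symbol as torus derivatives
  have hd1 : ∀ i, freqDeriv i (scal (mFourierCoeff χ) : (d → ℤ) → (V →L[ℂ] V)) =
      scal (mFourierCoeff (Torus.partialDeriv i χ)) := fun i => freqDeriv_scal_mFourierCoeff hχ i
  have hd2 : ∀ i j, freqDeriv i (scal (mFourierCoeff (Torus.partialDeriv j χ)) : (d → ℤ) → (V →L[ℂ] V)) =
      scal (mFourierCoeff (Torus.partialDeriv i (Torus.partialDeriv j χ))) := fun i j =>
    freqDeriv_scal_mFourierCoeff (hχ.partialDeriv j) i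
  have hrd1 : ∀ i, RapidDecay (scal (mFourierCoeff (Torus.partialDeriv i χ)) : (d → ℤ) → (V →L[ℂ] V)) :=
    fun i => (hχ.partialDeriv i).rapidDecay_scal
  have hrd2 : ∀ i j, RapidDecay (scal (mFourierCoeff (Torus.partialDeriv i (Torus.partialDeriv j χ))) :
      (d → ℤ) → (V →L[ℂ] V)) := fun i j => ((hχ.partialDeriv j).partialDeriv i).rapidDecay_scal
  refine POp1.apply_conv_scal_eq _ (fun j => rfl) hψ.rapidDecay_mFourierCoeff (fun j => ?_) (fun j => ?_) ?_ hu
  · -- `p_j ⋆ (ψ - 1) = 0`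
    rw [POp.cutoffComm_p]
    simp only [hd1]
    rw [finset_sum_sconv _ (fun i _ => ?_) hsub]
    · refine Finset.sum_eq_zero fun i _ => ?_
      rw [add_sconv ((((hrd1 i).compLeft _).add ((hrd1 i).compLeft _))) (((L.hb i j).sconv (hrd1 i)).add
          ((L.hb j i).sconv (hrd1 i))) hsub,
        add_sconv ((hrd1 i).compLeft _) ((hrd1 i).compLeft _) hsub,
        add_sconv ((L.hb i j).sconv (hrd1 i)) ((L.hb j i).sconv (hrd1 i)) hsub,
        ← compLeft_sconv _ (hrd1 i) hsub, ← compLeft_sconv _ (hrd1 i) hsub,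
        ← sconv_assoc (L.hb i j) (hrd1 i) hsub, ← sconv_assoc (L.hb j i) (hrd1 i) hsub,
        h.sconv_deriv_sub_delta i]
      simp [compLeft_zero, sconv_zero]
    · exact ((((hrd1 i).compLeft _).add ((hrd1 i).compLeft _))).add
        (((L.hb i j).sconv (hrd1 i)).add ((L.hb j i).sconv (hrd1 i)))
  · -- `p_j ⋆ ∂_jψ = 0`
    have hrψ : RapidDecay (freqDeriv j (scal (mFourierCoeff ψ) : (d → ℤ) → (V →L[ℂ] V))) := hsψ.freqDeriv j
    rw [POp.cutoffComm_p]
    simp only [hd1]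
    rw [finset_sum_sconv _ (fun i _ => ?_) hrψ]
    · refine Finset.sum_eq_zero fun i _ => ?_
      rw [add_sconv ((((hrd1 i).compLeft _).add ((hrd1 i).compLeft _))) (((L.hb i j).sconv (hrd1 i)).add
          ((L.hb j i).sconv (hrd1 i))) hrψ,
        add_sconv ((hrd1 i).compLeft _) ((hrd1 i).compLeft _) hrψ,
        add_sconv ((L.hb i j).sconv (hrd1 i)) ((L.hb j i).sconv (hrd1 i)) hrψ,
        ← compLeft_sconv _ (hrd1 i) hrψ, ← compLeft_sconv _ (hrd1 i) hrψ,
        ← sconv_assoc (L.hb i j) (hrd1 i) hrψ, ← sconv_assoc (L.hb j i) (hrd1 i) hrψ,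
        h.sconv_deriv_freqDeriv j i]
      simp [compLeft_zero, sconv_zero]
    · exact ((((hrd1 i).compLeft _).add ((hrd1 i).compLeft _))).add
        (((L.hb i j).sconv (hrd1 i)).add ((L.hb j i).sconv (hrd1 i)))
  · -- `p₀ ⋆ (ψ - 1) = 0`
    rw [POp.cutoffComm_p0]
    simp only [hd1, hd2]
    have hA : ∀ i j, RapidDecay (compLeft (L.A i j) (scal (mFourierCoeff (Torus.partialDeriv i (Torus.partialDeriv j χ))) :
        (d → ℤ) → (V →L[ℂ] V)) + sconv (L.b i j) (scal (mFourierCoeff (Torus.partialDeriv i (Torus.partialDeriv j χ))))) :=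
      fun i j => ((hrd2 i j).compLeft _).add ((L.hb i j).sconv (hrd2 i j))
    rw [add_sconv (RapidDecay.finset_sum _ fun i _ => RapidDecay.finset_sum _ fun j _ => hA i j)
        (RapidDecay.finset_sum _ fun j _ => (L.hc1 j).sconv (hrd1 j)) hsub,
      finset_sum_sconv _ (fun i _ => RapidDecay.finset_sum _ fun j _ => hA i j) hsub,
      finset_sum_sconv _ (fun j _ => (L.hc1 j).sconv (hrd1 j)) hsub]
    have e1 : ∀ i, sconv (∑ j, (compLeft (L.A i j) (scal (mFourierCoeff (Torus.partialDeriv i (Torus.partialDeriv j χ))) :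
        (d → ℤ) → (V →L[ℂ] V)) + sconv (L.b i j) (scal (mFourierCoeff (Torus.partialDeriv i (Torus.partialDeriv j χ))))))
        ((scal (mFourierCoeff ψ) : (d → ℤ) → (V →L[ℂ] V)) - delta 1) = 0 := fun i => by
      rw [finset_sum_sconv _ (fun j _ => hA i j) hsub]
      refine Finset.sum_eq_zero fun j _ => ?_
      rw [add_sconv ((hrd2 i j).compLeft _) ((L.hb i j).sconv (hrd2 i j)) hsub, ← compLeft_sconv _ (hrd2 i j) hsub,
        ← sconv_assoc (L.hb i j) (hrd2 i j) hsub, h.sconv_deriv_deriv_sub_delta i j]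
      simp [compLeft_zero, sconv_zero]
    have e2 : ∀ j, sconv (sconv (L.c1 j) (scal (mFourierCoeff (Torus.partialDeriv j χ)) : (d → ℤ) → (V →L[ℂ] V)))
        ((scal (mFourierCoeff ψ) : (d → ℤ) → (V →L[ℂ] V)) - delta 1) = 0 := fun j => by
      rw [← sconv_assoc (L.hc1 j) (hrd1 j) hsub, h.sconv_deriv_sub_delta j, sconv_zero]
    simp only [e1, e2, Finset.sum_const_zero, add_zero]

end Lattice

end Literature.Analysis.FunctionSpaces
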